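import Summits.CriticalPhenomena.PercolationContinuityZ3.Theorems.PercNearOneGluingNoHeavyLowerTailSahiSharedChainRatio
import Summits.CriticalPhenomena.PercolationContinuityZ3.Theorems.PercNearOneGluingNoHeavyLowerTailSahiSharedChainPhi
import Summits.CriticalPhenomena.PercolationContinuityZ3.Theorems.PercNearOneGluingNoHeavyLowerTailSahiSharedTwoPoint
import Literature.Combinatorics.Sahi2008.PushForward
import Mathlib.Tactic.Linarith
import Mathlib.Tactic.Ring
import HarnessLib

/-!
# `NoHeavyLowerTail` (crux stmt-CriticalPhenomena-4575), P2 — **THEOREM C: SAHI'S `C_3` WHEN THE `f`–`g` BLOCK IS A CHAIN, `h` ARBITRARY** (Lean)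

Memo SAHI-ROUTE.md §4.29(c) (seat `prim-masterthm-p2`, gen 8; `--supports stmt-CriticalPhenomena-4575`).  No `sorry`, no named facts, standard axioms.

SETTING.  `α, β` finite distributive lattices with FKG probability weights `wA, wB`; the block shared by `f` and `g` is the CHAIN `Fin (n+1)` with a
strictly positive probability weight `wC`; `f : Fin (n+1) → α → ℝ`, `g : Fin (n+1) → β → ℝ`, `h : Fin (n+1) → α → β → ℝ` nonnegative and monotone
in every argument — `h` is unrestricted.  **THEOREM (`sahiE_three_nonneg_sharedChain`): `E_3(f,g,h) ≥ 0`.**  Contains Theorem A (`n = 1`,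
`…SahiSharedTwoPoint`) and is incomparable with the class-T theorem (`…SahiTriangleClassT`).

PROOF (the ratio method of §4.29).  (1) The ratio-family identity `E_3 = E_b[Φ_r + Δ_r] + covpart_r` (`…SahiSharedTwoPointIdentity.sahiE_three_eq_of_ratio`)
with `r` := the TOP-DOWN WATER-FILLING ratio of the surplus `e = Ȳ − EH·F` (`…SahiSharedChainWaterfill`, `…SahiSharedChainRatio.rho`):
`z_top = e_top`, `z = min(e, average of z above)`, `r = (z + EH·F)/Ȳ`.  (2) `0 ≤ r ≤ 1` (`rho_spec`, via `z ≥ F·(H̄ − EH)` and Chebyshev on blocks)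
gives `covpart_r ≥ 0` (`covpart_nonneg_of_ratio`, FKG on `β`).  (3) `r` satisfies `(⋆) F(c') ≤ (1 − r_c + r_{c'})F(c)` (`star_topdown`, via `r/F`
non-increasing), hence `Φ_r(b) ≥ 0` pointwise (`…SahiSharedChainPhi.PhiOf_nonneg_chain`, pairwise symmetrisation on the chain).  (4) `Σ_b wB Δ_r(b) =
Cov_{wC}(G_C, z) ≥ 0` by top-heaviness of the water-filled profile (`topheavy`) and Abel summation (`cov_nonneg_of_topheavy`).
-/

noncomputable section

open scoped Classical

namespace Summit.CriticalPhenomena.PercolationContinuityZ3.Theorems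

namespace SahiSharedChain

open Finset
open Literature.Combinatorics.Sahi2008

/-! ## Part C: THEOREM C — Sahi's `C_3` when the `f`–`g` block is a chain (`γ = Fin (n+1)`), `h` arbitrary -/

section Assembly

open SahiSharedTwoPoint (Y FC HH GG GC Ybar Hbar EH EF Gbar PhiOf DeltaOf psiOf)

variable {α β : Type} [Fintype α] [Fintype β] {n : ℕ}
  {wA : α → ℝ} {wB : β → ℝ} {wC : Fin (n + 1) → ℝ}
  {f : Fin (n + 1) → α → ℝ} {g : Fin (n + 1) → β → ℝ} {h : Fin (n + 1) → α → β → ℝ}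

/-- Top-down enumeration of the chain `Fin (n+1)`: `lev k = n − k` (so `lev 0` is the top). [this work] -/
def lev (n k : ℕ) : Fin (n + 1) := ⟨n - k, by omega⟩

omit [Fintype α] [Fintype β] in
/-- `lev` is order-reversing. [this work] -/
theorem lev_anti {k k' : ℕ} (hkk : k ≤ k') : lev n k' ≤ lev n k := by
  show n - k' ≤ n - k; omega

omit [Fintype α] [Fintype β] in
/-- `lev n (n − c) = c`. [this work] -/
theorem lev_sub (c : Fin (n + 1)) : lev n (n - c.val) = c := by
  ext; show n - (n - c.val) = c.val; omega

omit [Fintype α] [Fintype β] in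
/-- A sum over `Fin (n+1)` as a top-down range sum. [folklore] -/
theorem sum_fin_eq_sum_lev (X : Fin (n + 1) → ℝ) : ∑ c, X c = ∑ k ∈ range (n + 1), X (lev n k) := by
  let X' : ℕ → ℝ := fun i => X ⟨min i n, by omega⟩
  have h1 : (∑ c : Fin (n + 1), X c) = ∑ c : Fin (n + 1), X' c.val := by
    refine sum_congr rfl fun c _ => ?_
    simp only [X']; congr 1; ext; simp only; exact (min_eq_left (by omega)).symm
  rw [h1, Fin.sum_univ_eq_sum_range X' (n + 1), ← sum_range_reflect X' (n + 1)]
  refine sum_congr rfl fun k hk => ?_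
  simp only [X', lev]
  congr 1; ext; simp only
  have := mem_range.mp hk
  omega

/-- **THEOREM C (Sahi's `C_3` when the block shared by `f` and `g` is a chain).**  `α, β` finite distributive lattices with FKG probability weights
`wA, wB`; the third block is the chain `Fin (n+1)` with a strictly positive probability weight `wC`; `f(c,a)`, `g(c,b)`, `h(c,a,b)` nonnegative
and monotone in every argument (so `h` is UNRESTRICTED).  Then `E_3(f,g,h) ≥ 0` under `wA ⊗ wB ⊗ wC`.  Proof: the ratio family
`sahiE_three_eq_of_ratio` with the top-down water-filling ratio; `Φ ≥ 0` by `PhiOf_nonneg_chain` and `(⋆)` (`star_topdown`); `E_b Δ ≥ 0` by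
top-heaviness and `cov_nonneg_of_topheavy`; the covariance part by `covpart_nonneg_of_ratio`.  SAHI-ROUTE §4.29(c). [this work] -/
theorem sahiE_three_nonneg_sharedChain [DistribLattice α] [DistribLattice β]
    (hA : IsFKGMeasure wA) (hB : IsFKGMeasure wB) (hC : ∀ c, 0 < wC c) (hC1 : ∑ c, wC c = 1)
    (hf0 : ∀ c a, 0 ≤ f c a) (hfa : ∀ c, Monotone (f c)) (hfc : ∀ a, Monotone (fun c => f c a))
    (hg0 : ∀ c b, 0 ≤ g c b) (hgb : ∀ c, Monotone (g c)) (hgc : ∀ b, Monotone (fun c => g c b))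
    (hh0 : ∀ c a b, 0 ≤ h c a b) (hhc : ∀ a b, Monotone (fun c => h c a b))
    (hha : ∀ c b, Monotone (fun a => h c a b)) (hhb : ∀ c a, Monotone (h c a)) :
    0 ≤ sahiE (fun q : α × β × Fin (n + 1) => wA q.1 * wB q.2.1 * wC q.2.2) 3
        ![fun q => f q.2.2 q.1, fun q => g q.2.2 q.2.1, fun q => h q.2.2 q.1 q.2.1] := by
  have hA0 := hA.nonneg; have hB0 := hB.nonneg
  have hC0 : ∀ c, 0 ≤ wC c := fun c => (hC c).le
  -- top-down sequences
  let wq : ℕ → ℝ := fun k => wC (lev n k)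
  let Fq : ℕ → ℝ := fun k => FC wA f (lev n k)
  let Yq : ℕ → ℝ := fun k => Ybar wA wB f h (lev n k)
  let Hq : ℕ → ℝ := fun k => Hbar wA wB h (lev n k)
  let EHv : ℝ := EH wA wB wC h
  let r : Fin (n + 1) → ℝ := fun c => rho wq Fq Yq EHv (n - c.val)
  -- environment hypotheses in top-down form
  have hwq : ∀ k, 0 < wq k := fun k => hC _
  have hFmono : Monotone (FC wA f) := fun c c' hcc => sum_le_sum fun a _ => mul_le_mul_of_nonneg_left (hfc a hcc) (hA0 a)
  have hF0 : ∀ c, 0 ≤ FC wA f c := fun c => sum_nonneg fun a _ => mul_nonneg (hA0 a) (hf0 c a)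
  have hHmono : Monotone (Hbar wA wB h) := fun c c' hcc => sum_le_sum fun b _ => mul_le_mul_of_nonneg_left
    (sum_le_sum fun a _ => mul_le_mul_of_nonneg_left (hhc a b hcc) (hA0 a)) (hB0 b)
  have hH0 : ∀ c, 0 ≤ Hbar wA wB h c := fun c => sum_nonneg fun b _ => mul_nonneg (hB0 b)
    (sum_nonneg fun a _ => mul_nonneg (hA0 a) (hh0 c a b))
  have hYmono : Monotone (Ybar wA wB f h) := fun c c' hcc => sum_le_sum fun b _ => mul_le_mul_of_nonneg_left
    (sum_le_sum fun a _ => mul_le_mul_of_nonneg_left (mul_le_mul (hfc a hcc) (hhc a b hcc) (hh0 c a b) (hf0 c' a)) (hA0 a)) (hB0 b)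
  have hFq0 : ∀ k, 0 ≤ Fq k := fun k => hF0 _
  have hFq : Antitone Fq := fun k k' hkk => hFmono (lev_anti hkk)
  have hYq : Antitone Yq := fun k k' hkk => hYmono (lev_anti hkk)
  have hHq0 : ∀ k, 0 ≤ Hq k := fun k => hH0 _
  have hHq : Antitone Hq := fun k k' hkk => hHmono (lev_anti hkk)
  have hYFH : ∀ k, Fq k * Hq k ≤ Yq k := fun k => SahiSharedTwoPoint.FHbar_le_Ybar hA hB0 hf0 hh0 hfa hha _
  have hsumw : ∑ j ∈ range (n + 1), wq j = 1 := by rw [← sum_fin_eq_sum_lev]; exact hC1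
  have hmean : ∑ j ∈ range (n + 1), wq j * Hq j = EHv * ∑ j ∈ range (n + 1), wq j := by
    rw [hsumw, mul_one]
    show ∑ j ∈ range (n + 1), wC (lev n j) * Hbar wA wB h (lev n j) = EH wA wB wC h
    rw [← sum_fin_eq_sum_lev (fun c => wC c * Hbar wA wB h c)]; rfl
  have RS := rho_spec (w := wq) (F := Fq) (Yb := Yq) (EH := EHv) hwq hFq0 hFq hHq0 hHq hYFH hmean
  -- the ratio r on Fin (n+1)
  have hr : ∀ c : Fin (n + 1), 0 ≤ r c ∧ r c ≤ 1 ∧ r c * Ybar wA wB f h c - EHv * FC wA f c = z wq (surplus Fq Yq EHv) (n - c.val) := by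
    intro c
    obtain ⟨h0, h1, h2, -⟩ := RS (n - c.val) (by omega)
    refine ⟨h0, h1, ?_⟩
    have e1 : Yq (n - c.val) = Ybar wA wB f h c := by show Ybar wA wB f h (lev n (n - c.val)) = _; rw [lev_sub]
    have e2 : Fq (n - c.val) = FC wA f c := by show FC wA f (lev n (n - c.val)) = _; rw [lev_sub]
    rw [← e1, ← e2]; exact h2
  -- the identity
  rw [SahiSharedTwoPoint.sahiE_three_eq_of_ratio r hA.sum_eq_one hB.sum_eq_one]
  have hcov := SahiSharedTwoPoint.covpart_nonneg_of_ratio (r := r) hA hB hC0 hf0 hg0 hgb hh0 hhb (fun c => (hr c).1) (fun c => (hr c).2.1)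
  refine add_nonneg ?_ hcov
  -- Σ_b wB (Φ + Δ) = Σ_b wB Φ + Σ_b wB Δ
  simp only [mul_add, sum_add_distrib]
  refine add_nonneg (sum_nonneg fun b _ => mul_nonneg (hB0 b) ?_) ?_
  · -- Φ_r(b) ≥ 0 by the chain lemma and (⋆)
    refine PhiOf_nonneg_chain hA hC0 hC1 hf0 hfa hfc hg0 hgc hh0 hhc hha (fun c => (hr c).1) (fun c => (hr c).2.1) ?_ b
    intro c c' hcc
    -- top-down indices k = n - c ≤ k' = n - c'
    have hs := star_topdown (w := wq) (F := Fq) (Yb := Yq) (EH := EHv) hwq hFq0 hFq hYq hHq0 hHq hYFH hmean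
      (k := n - c.val) (k' := n - c'.val) (by have := hcc; omega) (by omega)
    have e2 : Fq (n - c.val) = FC wA f c := by show FC wA f (lev n (n - c.val)) = _; rw [lev_sub]
    have e2' : Fq (n - c'.val) = FC wA f c' := by show FC wA f (lev n (n - c'.val)) = _; rw [lev_sub]
    rw [e2, e2'] at hs; exact hs
  · -- Σ_b wB Δ_r(b) = Σ_c wC GC(c) ztil(c) − Gbar Σ_c wC ztil(c) ≥ 0,  ztil = −ψ_r = water-filled z
    have hΔ : (∑ b, wB b * DeltaOf wA wB wC f g h r b) =
        Gbar wB wC g * (∑ c, wC c * psiOf wA wB wC f h r c) - ∑ c, wC c * (GC wB g c * psiOf wA wB wC f h r c) := by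
      unfold DeltaOf
      simp only [mul_sub, sum_sub_distrib]
      congr 1
      · unfold Gbar; rw [sum_mul]; exact sum_congr rfl fun b _ => by ring
      · rw [SahiTriangleClassT.swap_bc wB wC (fun b c => g c b * psiOf wA wB wC f h r c)]
        refine sum_congr rfl fun c _ => ?_
        unfold GC; rw [SahiTriangleClassT.pull wB (psiOf wA wB wC f h r c) (g c)]; ring
    rw [hΔ]
    -- ψ_r(c) = − z(n − c)
    have hψ : ∀ c, psiOf wA wB wC f h r c = - z wq (surplus Fq Yq EHv) (n - c.val) := by
      intro c; unfold psiOf; linarith [(hr c).2.2]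
    have hGbar : Gbar wB wC g = ∑ c, wC c * GC wB g c := by
      unfold Gbar GG GC; exact SahiTriangleClassT.swap_bc wB wC (fun b c => g c b)
    simp only [hψ, hGbar, mul_neg, sum_neg_distrib]
    -- goal: 0 ≤ (Σ wC GC) * -(Σ wC z̃) - -(Σ wC (GC * z̃))  i.e.  Σ wC GC z̃ ≥ (Σ wC GC)(Σ wC z̃)
    rw [sum_fin_eq_sum_lev (fun c => wC c * GC wB g c), sum_fin_eq_sum_lev (fun c => wC c * z wq (surplus Fq Yq EHv) (n - c.val)),
      sum_fin_eq_sum_lev (fun c => wC c * (GC wB g c * z wq (surplus Fq Yq EHv) (n - c.val)))]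
    have hidx : ∀ k ∈ range (n + 1), n - (lev n k).val = k := fun k hk => by
      show n - (n - k) = k; have := mem_range.mp hk; omega
    have hGq : Antitone (fun k => GC wB g (lev n k)) := fun k k' hkk =>
      sum_le_sum fun b _ => mul_le_mul_of_nonneg_left (hgc b (lev_anti hkk)) (hB0 b)
    have htop : ∀ u ≤ n, (∑ k ∈ range (n + 1), wq k) * (∑ k ∈ range (u + 1), wq k * z wq (surplus Fq Yq EHv) k) ≥
        (∑ k ∈ range (u + 1), wq k) * ∑ k ∈ range (n + 1), wq k * z wq (surplus Fq Yq EHv) k := by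
      intro u hu
      have ht := topheavy (w := wq) (e := surplus Fq Yq EHv) hwq hu
      rw [SW_snd, SW_fst] at ht
      exact ht
    have hcv := cov_nonneg_of_topheavy (w := wq) (X := z wq (surplus Fq Yq EHv)) (n := n) hGq htop
    rw [hsumw, one_mul] at hcv
    have e3 : (∑ k ∈ range (n + 1), wC (lev n k) * (GC wB g (lev n k) * z wq (surplus Fq Yq EHv) (n - (lev n k).val))) =
        ∑ k ∈ range (n + 1), wq k * GC wB g (lev n k) * z wq (surplus Fq Yq EHv) k :=
      sum_congr rfl fun k hk => by rw [hidx k hk]; ring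
    have e4 : (∑ k ∈ range (n + 1), wC (lev n k) * z wq (surplus Fq Yq EHv) (n - (lev n k).val)) =
        ∑ k ∈ range (n + 1), wq k * z wq (surplus Fq Yq EHv) k :=
      sum_congr rfl fun k hk => by rw [hidx k hk]
    rw [e3, e4]
    have e5 : (∑ k ∈ range (n + 1), wC (lev n k) * GC wB g (lev n k)) = ∑ k ∈ range (n + 1), wq k * GC wB g (lev n k) := rfl
    rw [e5]
    linarith [hcv]

end Assembly

section AnyChain

open SahiSharedTwoPoint (Y FC HH GG GC Ybar Hbar EH EF Gbar PhiOf DeltaOf psiOf)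

variable {α β γ : Type} [Fintype α] [Fintype β] [Fintype γ] [LinearOrder γ] [Nonempty γ]
  {wA : α → ℝ} {wB : β → ℝ} {wC : γ → ℝ} {f : γ → α → ℝ} {g : γ → β → ℝ} {h : γ → α → β → ℝ}

/-- **THEOREM C for an arbitrary finite nonempty chain `γ`** (transfer of `sahiE_three_nonneg_sharedChain` along the order isomorphism
`Fin (card γ) ≃o γ` with `sahiE_pushWeight`). [this work] -/
theorem sahiE_three_nonneg_sharedChain' [DistribLattice α] [DistribLattice β]
    (hA : IsFKGMeasure wA) (hB : IsFKGMeasure wB) (hC : ∀ c, 0 < wC c) (hC1 : ∑ c, wC c = 1)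
    (hf0 : ∀ c a, 0 ≤ f c a) (hfa : ∀ c, Monotone (f c)) (hfc : ∀ a, Monotone (fun c => f c a))
    (hg0 : ∀ c b, 0 ≤ g c b) (hgb : ∀ c, Monotone (g c)) (hgc : ∀ b, Monotone (fun c => g c b))
    (hh0 : ∀ c a b, 0 ≤ h c a b) (hhc : ∀ a b, Monotone (fun c => h c a b))
    (hha : ∀ c b, Monotone (fun a => h c a b)) (hhb : ∀ c a, Monotone (h c a)) :
    0 ≤ sahiE (fun q : α × β × γ => wA q.1 * wB q.2.1 * wC q.2.2) 3
        ![fun q => f q.2.2 q.1, fun q => g q.2.2 q.2.1, fun q => h q.2.2 q.1 q.2.1] := by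
  obtain ⟨n, hn⟩ : ∃ n, Fintype.card γ = n + 1 :=
    ⟨Fintype.card γ - 1, (Nat.succ_pred_eq_of_pos Fintype.card_pos).symm⟩
  let e : Fin (n + 1) ≃o γ := Fintype.orderIsoFinOfCardEq γ hn
  let G : α × β × γ → α × β × Fin (n + 1) := fun q => (q.1, q.2.1, e.symm q.2.2)
  have hG : Function.Injective G := by
    intro q q' hqq
    simp only [G, Prod.mk.injEq] at hqq
    obtain ⟨h1, h2, h3⟩ := hqq
    exact Prod.ext h1 (Prod.ext h2 (e.symm.injective h3))
  have hpush : pushWeight (fun q : α × β × γ => wA q.1 * wB q.2.1 * wC q.2.2) G =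
      fun q' => wA q'.1 * wB q'.2.1 * wC (e q'.2.2) := by
    funext q'
    have hq : q' = G (q'.1, q'.2.1, e q'.2.2) := by simp [G]
    rw [hq, pushWeight_apply_of_injective _ hG]
    simp [G]
  have key := sahiE_three_nonneg_sharedChain (n := n) (wA := wA) (wB := wB) (wC := fun c' => wC (e c'))
    (f := fun c' a => f (e c') a) (g := fun c' b => g (e c') b) (h := fun c' a b => h (e c') a b)
    hA hB (fun c' => hC _) (by rw [← hC1]; exact e.sum_comp (fun c => wC c))
    (fun c' a => hf0 _ a) (fun c' => hfa _) (fun a c1 c2 h12 => hfc a (e.monotone h12))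
    (fun c' b => hg0 _ b) (fun c' => hgb _) (fun b c1 c2 h12 => hgc b (e.monotone h12))
    (fun c' a b => hh0 _ a b) (fun a b c1 c2 h12 => hhc a b (e.monotone h12)) (fun c' b => hha _ b) (fun c' a => hhb _ a)
  have tr := sahiE_pushWeight (fun q : α × β × γ => wA q.1 * wB q.2.1 * wC q.2.2) G 3
    ![fun q' => f (e q'.2.2) q'.1, fun q' => g (e q'.2.2) q'.2.1, fun q' => h (e q'.2.2) q'.1 q'.2.1]
  rw [hpush] at tr
  have hfun : (fun i => (![fun q' : α × β × Fin (n + 1) => f (e q'.2.2) q'.1, fun q' => g (e q'.2.2) q'.2.1,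
      fun q' => h (e q'.2.2) q'.1 q'.2.1] i) ∘ G) =
      ![fun q : α × β × γ => f q.2.2 q.1, fun q => g q.2.2 q.2.1, fun q => h q.2.2 q.1 q.2.1] := by
    funext i q
    fin_cases i <;> simp [G]
  rw [hfun] at tr
  rw [← tr]; exact key

end AnyChain

end SahiSharedChain

end Summit.CriticalPhenomena.PercolationContinuityZ3.Theorems
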